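import Summits.PneNP.PneNP.Theorems.SfmBlMachineSpots

/-!
# Line «sfm-bl», MACHINE LAYER M4: the spot families and the bad-count tables in the `CodeFP` algebra (stmt-PneNP-20523)

FRONTIER F-N1c; nothing here bears on P vs NP.

MACHINE-PLAN (pnp-ideate-p3 g14, `HOME/pnp-ideate-p3/r15/MACHINE-PLAN.md`) stage **M4**: the integer
`Φ₂(k, T₀) = Σ_s Σ_{T ⊇ T₀|[0,k)} ê_s(T)` of the greedy potential.  By p3's `SfmBl.sum_cylinder_hat_eq`
(`SfmBlCylinderHat`) it is `Σ_s Σ_{W ∈ 𝒲 s} meet_s(W) · #{T ∈ cyl(k,T₀) : G·|W₁|·|W₂| < (Σ_j c_j(W) χ(T j))²}`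
with `G = γ'² = 6000·2^60`, `c_j(W) = #{legs of spot s of output j from W₁ to W₂}`, and the count is the
forward dynamic programme of `SfmBlCylinderDP` (`dpCount_zero / succ_of_mem / succ_of_not_mem / final`).

This file is the MACHINE (plain list functions + `CodeFP` typings), on the extraction output of M2b
(`SfmBlMachine.extract`: one label per pieced leg, `0` = remainder, `s + 1` = spot `s`):
* `slegs plegs labels s` — the legs of spot `s`; `lpieces / rpieces` — their left / right pieces;
* `sublistsC cap l` — all sublists of `l` (a capped fold; `= List.sublists l` when `2^|l| ≤ cap`,
  `sublistsC_eq_sublists`), so the SUB-PAIRS `(W₁ ⊆ V₁ s, W₂ ⊆ V₂ s)` are `sublistsC × sublistsC`;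
* `legsIn xs W` — the legs of `xs` from `W₁` to `W₂`; `connTest cap xs W` — the connectivity test of the pair
  inside the spot (a single piece, or some enumerated walk of the inside legs of length `2(|W₁|+|W₂|−1)` covers
  `W₁ ∪ W₂`; walks = M2a `walksC`); `meetCount xs W` — `#{legs of xs meeting W₁ or W₂}`;
* `spotRecs / allRecs` — the PAIR RECORDS `(|W₁|·|W₂|, meet, inside legs)` of all connected sub-pairs of all spots
  (computed ONCE, before the greedy loop);
* `dpInit / dpStep / dpTab k T0 xs m` — the table `i ↦ N_m(i − C)` on `[−C, C]`, `C = |xs|`, of the DP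
  (`j < k`: shift by `c_j χ(T₀ j)`; `j ≥ k`: convolution), `badCount G k T0 m rec` — the layer-cake sum over
  `G·ab < (i − C)²`, `hatSum G k T0 m recs = Σ_rec meet · badCount`.
Bookkeeping proved here: `sublistsC_eq_sublists`, `sublistsC_sublist` (cap invariant), `length_dpTab`,
`foldl_dpStep_le` (entries `≤ 2^{#steps}`).  The `CodeFP` typings are `SfmBlMachineHatFP`; the identification
with the `Finset` expression above is M4-SEM (`SfmBlMachineHatSpec`).
-/

set_option linter.dupNamespace false -- `Summit.PneNP.PneNP.…`: summit = sub-problem name (D-0017 single-conjunct layout)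

namespace Summit.PneNP.PneNP.Theorems.SfmBlMachine

open Literature.Computability.Complexity CodeFP

/-! ## The spec (plain list functions) -/

/-- The legs of spot `s` (label `s + 1`). -/
def slegs (plegs : List PLeg) (labels : List ℕ) (s : ℕ) : List PLeg :=
  ((labels.zip plegs).filter fun q => decide (q.1 = s + 1)).map Prod.snd

/-- Left pieces of a leg list (deduplicated). -/
def lpieces (xs : List PLeg) : List Lab := (xs.map labL).dedup

/-- Right pieces of a leg list (deduplicated). -/
def rpieces (xs : List PLeg) : List Lab := (xs.map labR).dedup

/-- One round of the sublist fold: keep every sublist and every sublist extended by `a`, capped. -/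
def sublStep (cap : ℕ) (acc : List (List Lab)) (a : Lab) : List (List Lab) :=
  (acc ++ acc.map fun s => s ++ [a]).take cap

/-- All sublists of `l` (capped fold the machine runs; `= List.sublists l` when `2^|l| ≤ cap`). -/
def sublistsC (cap : ℕ) (l : List Lab) : List (List Lab) := l.foldl (sublStep cap) [[]]

/-- The legs of `xs` from `W₁` to `W₂`. -/
def legsIn (xs : List PLeg) (W : Cand) : List PLeg :=
  xs.filter fun x => decide (labL x ∈ W.1) && decide (labR x ∈ W.2)

/-- CONNECTIVITY TEST of a sub-pair inside a leg list: a single piece, or some enumerated walk (M2a `walksC`,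
cap `cap`) of the inside legs of length `2(|W₁| + |W₂| − 1)` visits every piece of the pair. -/
def connTest (cap : ℕ) (xs : List PLeg) (W : Cand) : Bool :=
  decide ((W.1 ++ W.2).length = 1) ||
    (walksC (legsIn xs W) cap (List.replicate (2 * ((W.1 ++ W.2).length - 1)) ())).any
      fun w => (W.1 ++ W.2).all fun P => decide (P ∈ w.2)

/-- `meet(W)`: the number of legs of `xs` with left piece in `W₁` or right piece in `W₂`. -/
def meetCount (xs : List PLeg) (W : Cand) : ℕ :=
  (xs.filter fun x => decide (labL x ∈ W.1) || decide (labR x ∈ W.2)).length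

/-- A PAIR RECORD `(|W₁|·|W₂|, meet(W), legs inside W)`. -/
abbrev PRec := ℕ × ℕ × List PLeg

/-- The record of a sub-pair. -/
def mkRec (xs : List PLeg) (W : Cand) : PRec := (W.1.length * W.2.length, meetCount xs W, legsIn xs W)

/-- The sub-pairs of a leg list (sublists of the left pieces × sublists of the right pieces). -/
def subPairs (capS : ℕ) (xs : List PLeg) : List Cand := (sublistsC capS (lpieces xs)).product (sublistsC capS (rpieces xs))

/-- The pair records of one spot: connected sub-pairs only. -/
def spotRecs (capS capW : ℕ) (xs : List PLeg) : List PRec :=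
  ((subPairs capS xs).filter (connTest capW xs)).map (mkRec xs)

/-- The pair records of all spots `s < r`. -/
def allRecs (capS capW : ℕ) (plegs : List PLeg) (labels : List ℕ) (r : ℕ) : List PRec :=
  ((List.range r).map fun s => spotRecs capS capW (slegs plegs labels s)).flatten

/-- `c_j`: the number of legs of output `j` in a leg list. -/
def cOut (xs : List PLeg) (j : ℕ) : ℕ := (xs.filter fun x => decide (x.1 = j)).length

/-- Reading a table at an integer index (`0` outside). -/
def getZ (tab : List ℕ) (z : ℤ) : ℕ := if z < 0 then 0 else tab.getD z.toNat 0

/-- The signed shift `c_j χ(T₀ j)` (`χ(true) = −1`). -/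
def cSgn (T0 : List Bool) (xs : List PLeg) (j : ℕ) : ℤ := if T0.getD j false then -(cOut xs j : ℤ) else (cOut xs j : ℤ)

/-- One entry of the next table. -/
def dpEntry (k : ℕ) (T0 : List Bool) (xs : List PLeg) (tab : List ℕ) (j i : ℕ) : ℕ :=
  if j < k then getZ tab ((i : ℤ) - cSgn T0 xs j)
  else getZ tab ((i : ℤ) - (cOut xs j : ℤ)) + getZ tab ((i : ℤ) + (cOut xs j : ℤ))

/-- One DP step at output `j`: shift on a fixed output (`j < k`), convolution on a free one. -/
def dpStep (k : ℕ) (T0 : List Bool) (xs : List PLeg) (tab : List ℕ) (j : ℕ) : List ℕ :=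
  (List.range tab.length).map (dpEntry k T0 xs tab j)

/-- The initial table `δ_0` on `[−C, C]`, `C = |xs|`. -/
def dpInit (xs : List PLeg) : List ℕ := (List.range (2 * xs.length + 1)).map fun i => if i = xs.length then 1 else 0

/-- The DP table after processing outputs `0, …, m − 1`. -/
def dpTab (k : ℕ) (T0 : List Bool) (xs : List PLeg) (m : ℕ) : List ℕ :=
  (List.range m).foldl (dpStep k T0 xs) (dpInit xs)

/-- The value test of the layer cake at index `i`: `G·ab < (i − C)²`. -/
def badIdx (G ab C i : ℕ) : Bool := decide ((G * ab : ℤ) < ((i : ℤ) - (C : ℤ)) ^ 2)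

/-- The number of completions making the pair bad: `Σ_{i : G·ab < (i−C)²} table[i]`. -/
def badCount (G k : ℕ) (T0 : List Bool) (m : ℕ) (rec : PRec) : ℕ :=
  ((((List.range (2 * rec.2.2.length + 1)).zip (dpTab k T0 rec.2.2 m)).filter
      fun q => badIdx G rec.1 rec.2.2.length q.1).map Prod.snd).sum

/-- **The machine's value of `Σ_s Σ_{T ⊇ T₀|[0,k)} ê_s(T)`**: `Σ_rec meet · badCount`. -/
def hatSum (G k : ℕ) (T0 : List Bool) (m : ℕ) (recs : List PRec) : ℕ :=
  (recs.map fun rec => rec.2.1 * badCount G k T0 m rec).sum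

/-! ## The capped sublist fold -/

/-- Uncapped, the fold computes `List.sublists`. -/
theorem foldl_sublStep_eq (cap : ℕ) : ∀ (l pre : List Lab),
    (∀ l', List.Sublist l' (pre ++ l) → 2 ^ l'.length ≤ cap) →
    l.foldl (sublStep cap) (List.sublists pre) = List.sublists (pre ++ l) := by
  intro l
  induction l with
  | nil => intro pre _; simp
  | cons a l ih =>
    intro pre hcap
    rw [List.foldl_cons]
    have h1 : sublStep cap (List.sublists pre) a = List.sublists (pre ++ [a]) := by
      unfold sublStep
      rw [List.sublists_concat]
      apply List.take_of_length_le
      rw [← List.sublists_concat, List.length_sublists]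
      exact hcap (pre ++ [a]) (by simp)
    rw [h1, ih (pre ++ [a]) (fun l' hl' => hcap l' (by simpa using hl')), List.append_assoc,
      List.singleton_append]

/-- **If `2^|l| ≤ cap` the capped fold IS `List.sublists l`.** -/
theorem sublistsC_eq_sublists {cap : ℕ} {l : List Lab} (h : 2 ^ l.length ≤ cap) : sublistsC cap l = List.sublists l := by
  have := foldl_sublStep_eq cap l [] (fun l' hl' => le_trans (Nat.pow_le_pow_right (by norm_num)
    (by simpa using hl'.length_le)) h)
  simpa [sublistsC] using this

/-- Invariant of the capped fold: every kept list is a sublist of the processed prefix, at most `max 1 cap` lists. -/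
theorem sublistsC_inv (cap : ℕ) : ∀ (l pre : List Lab) (acc : List (List Lab)),
    (∀ s ∈ acc, List.Sublist s pre) → acc.length ≤ max 1 cap →
    (∀ s ∈ l.foldl (sublStep cap) acc, List.Sublist s (pre ++ l)) ∧ (l.foldl (sublStep cap) acc).length ≤ max 1 cap := by
  intro l
  induction l with
  | nil => intro pre acc h hl; simpa using And.intro h hl
  | cons a l ih =>
    intro pre acc h _
    rw [List.foldl_cons, ← List.singleton_append, ← List.append_assoc]
    refine ih (pre ++ [a]) _ (fun s hs => ?_) ((List.length_take_le _ _).trans (le_max_right _ _))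
    unfold sublStep at hs
    have hs' := List.mem_of_mem_take hs
    rw [List.mem_append, List.mem_map] at hs'
    rcases hs' with hs' | ⟨s', hs', rfl⟩
    · exact (h s hs').trans (List.sublist_append_left _ _)
    · exact List.Sublist.append (h s' hs') (List.Sublist.refl _)

/-- Every item of `sublistsC cap l` is a sublist of `l`, and there are at most `max 1 cap` of them. -/
theorem sublistsC_sublist (cap : ℕ) (l : List Lab) :
    (∀ s ∈ sublistsC cap l, List.Sublist s l) ∧ (sublistsC cap l).length ≤ max 1 cap := by
  have := sublistsC_inv cap l [] [[]] (fun s hs => by simp at hs; simp [hs]) (by simp)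
  simpa [sublistsC] using this

/-! ## The DP table keeps its length -/

/-- One DP step keeps the table length. -/
theorem length_dpStep (k : ℕ) (T0 : List Bool) (xs : List PLeg) (tab : List ℕ) (j : ℕ) :
    (dpStep k T0 xs tab j).length = tab.length := by
  simp [dpStep]

/-- The DP table has `2C + 1` entries. -/
theorem length_dpTab (k : ℕ) (T0 : List Bool) (xs : List PLeg) (m : ℕ) : (dpTab k T0 xs m).length = 2 * xs.length + 1 := by
  unfold dpTab
  suffices h : ∀ (l : List ℕ) (tab : List ℕ), (l.foldl (dpStep k T0 xs) tab).length = tab.length by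
    rw [h]; simp [dpInit]
  intro l
  induction l with
  | nil => intro tab; rfl
  | cons j l ih => intro tab; rw [List.foldl_cons, ih, length_dpStep]

/-- Entries of the initial table are `≤ 1`. -/
theorem dpInit_le (xs : List PLeg) : ∀ x ∈ dpInit xs, x ≤ 1 := by
  intro x hx
  unfold dpInit at hx
  rw [List.mem_map] at hx
  obtain ⟨i, _, rfl⟩ := hx
  split_ifs <;> simp

/-- `getZ` is bounded by the table's bound. -/
theorem getZ_le {tab : List ℕ} {B : ℕ} (h : ∀ x ∈ tab, x ≤ B) (z : ℤ) : getZ tab z ≤ B := by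
  unfold getZ
  split_ifs
  · exact Nat.zero_le _
  · rw [List.getD_eq_getElem?_getD]
    cases hq : tab[z.toNat]? with
    | none => simp
    | some x => simpa using h x (List.mem_of_getElem? hq)

/-- One DP step at most doubles the entries. -/
theorem dpStep_le {k : ℕ} {T0 : List Bool} {xs : List PLeg} {tab : List ℕ} {B : ℕ} (h : ∀ x ∈ tab, x ≤ B) (j : ℕ) :
    ∀ x ∈ dpStep k T0 xs tab j, x ≤ 2 * B := by
  intro x hx
  unfold dpStep at hx
  rw [List.mem_map] at hx
  obtain ⟨i, _, rfl⟩ := hx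
  unfold dpEntry
  split_ifs
  · exact (getZ_le h _).trans (by omega)
  · exact (Nat.add_le_add (getZ_le h _) (getZ_le h _)).trans (by omega)

/-- Along the fold the entries are `≤ 2^{#steps}`. -/
theorem foldl_dpStep_le (k : ℕ) (T0 : List Bool) (xs : List PLeg) :
    ∀ (l : List ℕ) (tab : List ℕ) (B : ℕ), (∀ x ∈ tab, x ≤ B) → ∀ x ∈ l.foldl (dpStep k T0 xs) tab, x ≤ 2 ^ l.length * B := by
  intro l
  induction l with
  | nil => intro tab B h x hx; simpa using h x hx
  | cons j l ih =>
    intro tab B h x hx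
    rw [List.foldl_cons] at hx
    have := ih _ (2 * B) (dpStep_le h j) x hx
    rw [List.length_cons, pow_succ]
    calc x ≤ 2 ^ l.length * (2 * B) := this
      _ = 2 ^ l.length * 2 * B := by ring

end Summit.PneNP.PneNP.Theorems.SfmBlMachine
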